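import Literature.NumberTheory.EllipticCurves.Kato2004.IwasawaH1Reduction
import Literature.NumberTheory.EllipticCurves.TateModuleProjSurjectiveProofs
import Literature.NumberTheory.EllipticCurves.TateModuleRank
import HarnessLib

/-!
# Kato 2004 (Astérisque 295) §13.8 at a finite level: the kernel of the reduction
# `H¹(F, T_pW) → H¹(F, W[p])` is exactly `p·H¹(F, T_pW)`

Topic `NumberTheory/EllipticCurves`, sub-directory `Kato2004` (namespace = path).  Cell `bsd-smallim`
(rung K6 of `BirchSwinnertonDyer`, class X9, crux `MuTransferX9` = item 19276), seat `bsd-smallim-k6-g4`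
(gen 2).  THEOREMS ONLY (no definition, no named fact, no `sorry`).  First of the two steps towards
DISCHARGING the named fact `Kato2004.mem_pSmul_of_red_eq_zero` (`IwasawaH1Reduction.lean` §4, the first
conjunct of the crux's cite-only stub `stub_factsX9`): the LEVELWISE statement.

## What

For `W/ℚ` elliptic, a prime `p` and any subgroup `U ≤ Γ_ℚ` (`U = Gal(ℚ̄/F)`):

* §1 (generic abelian group `A`, `T_p A = lim← A[p^n]` in the tree's coordinate model
  `TateModule A p ⊆ (ℕ → A)`; the tree's `proj_zero` (`a_0 = 0`) and `pow_smul_proj_succ`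
  (`p^n • a_{n+1} = a_1`) are reused): `proj_succ_prime_nsmul`, **`eq_of_prime_nsmul_eq`** (`T_p A` has no `p`-torsion: `p • a = p • b → a = b`,
  since `(p • a)_{n+1} = a_n`), **`exists_prime_nsmul_eq_of_proj_one_eq_zero`** (the kernel of the
  reduction `a ↦ a_1` is `p · T_p A`: if `a_1 = 0` then `a = p • b` with `b_n = a_{n+1}`).
* §2 **`exists_smul_eq_of_reduceH1_eq_zero`** — if `x ∈ H¹(U, T_pW)` has `red x = 0` in `H¹(U, W[p])`
  (`Kato2004.reduceH1`, the change of coefficients `T_pW → W[p]` on continuous cochains), then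
  `x = p • z` for some `z ∈ H¹(U, T_pW)`; with the proved converse `reduceH1_natCast_smul` this is
  **`reduceH1_eq_zero_iff`**: `ker (red : H¹(U, T_pW) → H¹(U, W[p])) = p · H¹(U, T_pW)` — the piece
  "`H¹(T) →p H¹(T) → H¹(T/p)` is exact" of the cohomology sequence of `0 → T_pW →p T_pW → W[p] → 0` at
  the level `F`, which is what Kato's "`𝐇¹(T)/p𝐇¹(T) ⊂ 𝐇¹(T/p)`" (§13.8, p. 229) says levelwise.

PROOF (§2), on cocycles — no long exact sequence is invoked: write `x = [φ]`; `red [φ] = [φ mod p] = 0`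
gives `v ∈ W[p]` with `φ(g) mod p = g v − v`; lift `v = m mod p` with `m ∈ T_pW` (the tree's PROVED
`WeierstrassCurve.proj_surjective_of_isAlgClosed_holds`: `T_pW → W[p]` is onto because `[p]` is onto on
`E(ℚ̄)`); then `c'(g) := φ(g) − (g m − m)` has `c'(g) mod p = 0`, so `c'(g) = p • d(g)` with
`d(g)_n = c'(g)_{n+1}` (§1) — `d` is continuous (coordinatewise) and a crossed homomorphism because
`p • (d(gh) − d(g) − g d(h)) = 0` and `T_pW` has no `p`-torsion (§1); finally `[φ] = [c'] = p • [d]`.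

What is NOT here (file 2 of the plan): the passage from the levels to the pin `IwasawaH1Data`
(`𝐇¹ = lim←_n H¹(ℤ_n[1/p], T_pW)`): a norm-compatible choice of the `p`-th roots `z_n` (the root sets are
finite torsors under `δ(H⁰(ℚ_n, W[p]))`; inverse limit of non-empty finite sets) and their integrality
(Kato's Lemma 8.5 (2): norm-compatible families are unramified away from `p`).

## The printed statements (K. Kato, Astérisque 295 (2004))

* **§13.8, proof of Thm. 12.4 (3) [p. 229]** "By `𝐇¹(T)/x𝐇¹(T) ⊂ H¹(ℤ[1/p], T ⊗_{O_λ} Λ/xΛ)` …"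
  (for the non-zero-divisor `x = p` of `Λ`; from the exact sequence of
  `0 → T ⊗ Λ →x T ⊗ Λ → T ⊗ Λ/xΛ → 0`, p. 228).
* **§8.2 [p. 180]** `H^q(R, T) = lim←_n H^q(R, T/p^n)` for a finitely generated `ℤ_p`-module `T` with
  continuous `Gal`-action (so that the cohomology of `T` is continuous-cochain cohomology, as in the tree).

References: K. Kato, Astérisque 295 (2004) §8.2, §13.8 [Kato2004Asterisque]; K. Rubin, *Euler Systems*
(2000) App. B Prop. B.2.3 (continuous cohomology of `lim T/p^n`) [Rubin2000]; J.-P. Serre, *Galois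
Cohomology* (1997) I §2.2 (cochains, `H¹ = Z¹/B¹`) [SerreGaloisCohomology1997]; J. H. Silverman, *AEC*
III §7 (`T_ℓ(E)`) [SilvermanAEC2009].
-/

noncomputable section

open scoped NumberField
open Field CategoryTheory
open Literature.NumberTheory.GaloisRepresentations
open Literature.NumberTheory.EllipticCurves Literature.NumberTheory.EllipticCurves.Kato2004
open Literature.NumberTheory.EllipticCurves.Kato2004.EulerSystemValues
open WeierstrassCurve (geomPoints geomTorsion)

universe u

/-! ## §1 `T_p A`: no `p`-torsion, and the kernel of `a ↦ a_1` is `p · T_p A` -/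

namespace Literature.NumberTheory.EllipticCurves.TateModule

variable {A : Type u} [AddCommGroup A] {p : ℕ}

/-- The components of `p • a`: `(p • a)_{n+1} = a_n`. [cite: Serre1968, Ch. I §1.1] -/
theorem proj_succ_prime_nsmul (n : ℕ) (a : TateModule A p) :
    proj p (n + 1) (p • a) = proj p n a := by
  rw [map_nsmul, smul_proj_succ]

/-- **`T_p A` has no `p`-torsion**: `p • a = p • b → a = b` (compare the components
`(p • a)_{n+1} = a_n`).  For `A = E(ℚ̄)` this is the torsion-freeness of the Tate module `T_pE`.
[cite: Serre1968, Ch. I §1.1] -/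
theorem eq_of_prime_nsmul_eq {a b : TateModule A p} (h : p • a = p • b) : a = b := by
  refine TateModule.ext fun n => ?_
  rw [← proj_succ_prime_nsmul n a, ← proj_succ_prime_nsmul n b, h]

/-- `p • a = 0 → a = 0` in `T_p A`. [cite: Serre1968, Ch. I §1.1] -/
theorem eq_zero_of_prime_nsmul_eq_zero {a : TateModule A p} (h : p • a = 0) : a = 0 :=
  eq_of_prime_nsmul_eq (by rw [h, nsmul_zero])

/-- **The kernel of the reduction `T_p A → A[p]`, `a ↦ a_1`, is `p · T_p A`**: if `a_1 = 0` then
`a = p • b` where `b_n = a_{n+1}` (a compatible sequence since `p^n • a_{n+1} = a_1 = 0`).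
[cite: Serre1968, Ch. I §1.1] -/
theorem exists_prime_nsmul_eq_of_proj_one_eq_zero (a : TateModule A p) (ha : proj p 1 a = 0) :
    ∃ b : TateModule A p, p • b = a ∧ ∀ n, proj p n b = proj p (n + 1) a := by
  refine ⟨TateModule.mk (fun n => proj p (n + 1) a) (fun n => ?_) (fun n => smul_proj_succ (n + 1) a),
    ?_, fun n => rfl⟩
  · rw [pow_smul_proj_succ, ha]
  · refine TateModule.ext fun n => ?_
    rw [map_nsmul, proj_mk, smul_proj_succ]

end Literature.NumberTheory.EllipticCurves.TateModule

/-! ## §2 The kernel of `red : H¹(U, T_pW) → H¹(U, W[p])` is `p · H¹(U, T_pW)` -/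

namespace Literature.NumberTheory.EllipticCurves.Kato2004

variable (W : WeierstrassCurve ℚ) [W.IsElliptic] (p : ℕ) [Fact p.Prime]
  [ContinuousSMul ℤ_[p] (W.tateModule p)]

/-- **Levelwise Kato §13.8: `ker red ⊆ p·H¹`.**  For every subgroup `U ≤ Γ_ℚ` and every
`x ∈ H¹(U, T_pW)` whose reduction `red x ∈ H¹(U, W[p])` vanishes, `x = p • z` for some `z ∈ H¹(U, T_pW)`
(exactness of `H¹(U, T_pW) →p H¹(U, T_pW) → H¹(U, W[p])`, proved on continuous cochains: module
docstring, PROOF). [cite: Kato2004Asterisque, §13.8 (pp. 228–229)] -/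
theorem exists_smul_eq_of_reduceH1_eq_zero (U : Subgroup (absoluteGaloisGroup ℚ))
    (x : H1 (tateRep W p) U) (hx : reduceH1 W p U x = 0) :
    ∃ z : H1 (tateRep W p) U, (p : ℤ_[p]) • z = x := by
  obtain ⟨φ, rfl⟩ := oneCocycleClass_surjective _ x
  rw [reduceH1_oneCocycleClass, oneCocycleClass_eq_zero_iff] at hx
  obtain ⟨v, hv⟩ := hx
  -- the action of `U` on `T_pW|_U` is the Galois action
  have hρ : ∀ (g : U) (a : W.tateModule p),
      (subgroupRep (tateRep W p).toTopRep U).ρ g a = (g : absoluteGaloisGroup ℚ) • a :=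
    fun g a => rfl
  -- the values of `φ` reduce to the coboundary of `v`
  have hv' : ∀ g : U, TateModule.proj p 1 (φ.1 g) =
      (g : absoluteGaloisGroup ℚ) • (v : geomPoints W) - (v : geomPoints W) := fun g => by
    have h := congrArg (fun P : geomTorsion W (p : ℤ) => (P : geomPoints W)) (hv g)
    simp only [AddSubgroupClass.coe_sub] at h
    exact h
  -- lift `v` to `m ∈ T_pW` (`T_pW → W[p]` is onto)
  have hvp : (v : geomPoints W) ∈ geomTorsion W (p ^ 1 : ℕ) := by rw [pow_one]; exact v.2
  obtain ⟨m, hm⟩ := W.proj_surjective_of_isAlgClosed_holds p 1 hvp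
  -- the corrected values `c' g = φ g − (g m − m)` reduce to `0`
  let c' : U → W.tateModule p := fun g =>
    φ.1 g - ((subgroupRep (tateRep W p).toTopRep U).ρ g m - m)
  have hc'cont : Continuous c' :=
    φ.1.continuous.sub ((((tateRep W p).continuous_apply_left m).comp continuous_subtype_val).sub
      continuous_const)
  have hc'1 : ∀ g, TateModule.proj p 1 (c' g) = 0 := fun g => by
    simp only [c', map_sub, hρ, TateModule.proj_smul_of_distribMulAction, hm, hv']
    abel
  have hc'mul : ∀ g h : U, c' (g * h) = c' g + (subgroupRep (tateRep W p).toTopRep U).ρ g (c' h) :=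
    fun g h => by
    have hgh : (subgroupRep (tateRep W p).toTopRep U).ρ (g * h) m =
        (subgroupRep (tateRep W p).toTopRep U).ρ g ((subgroupRep (tateRep W p).toTopRep U).ρ h m) := by
      rw [map_mul]; rfl
    simp only [c', φ.2 g h, hgh, map_sub]
    abel
  -- `d g := c' g / p`, coordinatewise `(d g)_n = (c' g)_{n+1}`
  let d₀ : U → W.tateModule p := fun g =>
    TateModule.mk (fun n => TateModule.proj p (n + 1) (c' g))
      (fun n => by rw [TateModule.pow_smul_proj_succ, hc'1])
      (fun n => TateModule.smul_proj_succ (n + 1) (c' g))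
  have hd₀ : ∀ g, p • d₀ g = c' g := fun g => by
    refine TateModule.ext fun n => ?_
    rw [map_nsmul, TateModule.proj_mk, TateModule.smul_proj_succ]
  have hd₀cont : Continuous d₀ := by
    refine continuous_induced_rng.mpr (continuous_pi fun n => ?_)
    exact (TateModule.continuous_proj (n + 1)).comp hc'cont
  -- `d` is a crossed homomorphism: `p •` of the defect vanishes and `T_pW` has no `p`-torsion
  have hdmul : ∀ g h : U, d₀ (g * h) = d₀ g + (subgroupRep (tateRep W p).toTopRep U).ρ g (d₀ h) :=
    fun g h => by
    refine TateModule.eq_of_prime_nsmul_eq ?_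
    rw [hd₀, nsmul_add, hd₀, ← map_nsmul, hd₀, hc'mul]
  let d : contOneCocycles (subgroupRep (tateRep W p).toTopRep U) := ⟨⟨d₀, hd₀cont⟩, hdmul⟩
  refine ⟨oneCocycleClass _ d, ?_⟩
  -- `[φ] = p • [d]`: `φ − p • d = ∂m`
  rw [← oneCocycleClass_smul, eq_comm, ← sub_eq_zero, ← oneCocycleClass_sub,
    oneCocycleClass_eq_zero_iff]
  refine ⟨m, fun g => ?_⟩
  rw [Submodule.coe_sub, ContinuousMap.sub_apply, Submodule.coe_smul, ContinuousMap.smul_apply,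
    Nat.cast_smul_eq_nsmul]
  change φ.1 g - p • d₀ g = (subgroupRep (tateRep W p).toTopRep U).ρ g m - m
  rw [hd₀]
  simp only [c', sub_sub_cancel]

/-- **`ker (red : H¹(U, T_pW) → H¹(U, W[p])) = p · H¹(U, T_pW)`** (Kato §13.8 at the level `U`):
`red x = 0 ↔ ∃ z, x = p • z` (`exists_smul_eq_of_reduceH1_eq_zero` and the proved converse
`reduceH1_natCast_smul`). [cite: Kato2004Asterisque, §13.8 (pp. 228–229)] -/
theorem reduceH1_eq_zero_iff (U : Subgroup (absoluteGaloisGroup ℚ)) (x : H1 (tateRep W p) U) :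
    reduceH1 W p U x = 0 ↔ ∃ z : H1 (tateRep W p) U, (p : ℤ_[p]) • z = x := by
  refine ⟨exists_smul_eq_of_reduceH1_eq_zero W p U x, ?_⟩
  rintro ⟨z, rfl⟩
  exact reduceH1_natCast_smul W p U z

end Literature.NumberTheory.EllipticCurves.Kato2004

end
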